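import Summits.Ventures.PercRepro.S1CFGDepFourBase
import Summits.Ventures.PercRepro.S1CFGSeriesClass

/-!
# PercRepro — THE DEPENDENT `4`-SETS MEETING A SERIES CLASS (p1, gen 40)

`M` finite, simple (no dependent pair); `Z ⊆ E` a set such that EVERY CIRCUIT MEETING `Z` CONTAINS `Z` (the series
class of a point, S1CFGSeriesClass). `D₄(S) := #{X ⊆ S : |X| = 4, rk X ≤ 3}`, `c₃(S)` the rank-`2` triples.
* `ncard_four_eRk_le_three_le_sdiff_add_of_circuits` — THE SPLIT: `D₄(E) ≤ D₄(E ∖ Z) + |Z|·c₃(E ∖ Z) + #ℬ`, where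
  `ℬ` = the dependent `4`-sets CONTAINING `Z`: a dependent `4`-set `X` meeting `Z` contains a circuit `C`; either
  `C ⊇ Z` (so `X ∈ ℬ`), or `C` avoids `Z`, and then `C = X ∖ Z` is a rank-`2` triple and `X = C ∪ {z}`;
* `#ℬ` by `|Z|`: `0` for `|Z| ≥ 5`, `≤ 1` for `|Z| = 4`, `≤ n − 3` for `|Z| = 3` (`X = Z ∪ {x}`), and for `Z = {e, f}`
  a series pair `≤ (n − 3) + #𝒬` with `𝒬` the `4`-circuits through `e, f` (`X ⊇` the unique rank-`2` triple through `e`,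
  or `X` is itself a circuit), where `2·#𝒬 ≤ (n − 2)(ν − 1)` (every `x ∉ {e, f}` lies in at most `|cl {e, f, x}| − 3 ≤ ν − 1`
  of them: `cl {e, f, x}` is a proper flat of rank `3` when `n ≥ ν + 4`).
Nothing about any cell is claimed. Axioms: standard.
-/

open scoped Matroid

namespace PercRepro

namespace S1CFG

open Set S1CF

variable {α : Type}

/-- **THE SPLIT** of the dependent `4`-sets along a set `Z` met only by circuits containing it:
`D₄(E) ≤ D₄(E ∖ Z) + |Z|·c₃(E ∖ Z) + #{dependent 4-sets ⊇ Z}`. -/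
theorem ncard_four_eRk_le_three_le_sdiff_add_of_circuits (M : Matroid α) [M.Finite]
    (h0 : {P : Set α | P ⊆ M.E ∧ P.ncard = 2 ∧ M.Dep P}.ncard = 0) (hn : 2 ≤ M.E.ncard) {Z : Set α}
    (hZE : Z ⊆ M.E) (hZ : ∀ C, M.IsCircuit C → ∀ z ∈ Z, z ∈ C → Z ⊆ C) :
    {X : Set α | X ⊆ M.E ∧ X.ncard = 4 ∧ M.eRk X ≤ 3}.ncard ≤
      {X : Set α | X ⊆ M.E \ Z ∧ X.ncard = 4 ∧ M.eRk X ≤ 3}.ncard +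
      Z.ncard * {T : Set α | T ⊆ M.E \ Z ∧ T.ncard = 3 ∧ M.eRk T ≤ 2}.ncard +
      {X : Set α | X ⊆ M.E ∧ X.ncard = 4 ∧ M.eRk X ≤ 3 ∧ Z ⊆ X}.ncard := by
  have hEfin := M.ground_finite
  have hZfin : Z.Finite := hEfin.subset hZE
  set 𝒯 := {T : Set α | T ⊆ M.E \ Z ∧ T.ncard = 3 ∧ M.eRk T ≤ 2} with h𝒯
  set 𝒜 := (fun p : Set α × α => insert p.2 p.1) '' (𝒯 ×ˢ Z) with h𝒜
  have h𝒯fin : 𝒯.Finite := hEfin.finite_subsets.subset (fun T hT => hT.1.trans sdiff_subset)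
  have h𝒜card : 𝒜.ncard ≤ Z.ncard * 𝒯.ncard := by
    calc 𝒜.ncard ≤ (𝒯 ×ˢ Z).ncard := Set.ncard_image_le (h𝒯fin.prod hZfin)
      _ = 𝒯.ncard * Z.ncard := Set.ncard_prod
      _ = Z.ncard * 𝒯.ncard := mul_comm _ _
  have hsub : {X : Set α | X ⊆ M.E ∧ X.ncard = 4 ∧ M.eRk X ≤ 3} ⊆
      ({X : Set α | X ⊆ M.E \ Z ∧ X.ncard = 4 ∧ M.eRk X ≤ 3} ∪ 𝒜) ∪
      {X : Set α | X ⊆ M.E ∧ X.ncard = 4 ∧ M.eRk X ≤ 3 ∧ Z ⊆ X} := by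
    intro X hX
    obtain ⟨hXE, hX4, hXr⟩ := hX
    have hXfin : X.Finite := hEfin.subset hXE
    rcases (X ∩ Z).eq_empty_or_nonempty with hXZ | hXZ
    · -- `X` avoids `Z`
      left; left
      refine ⟨fun x hx => ⟨hXE hx, fun hxZ => ?_⟩, hX4, hXr⟩
      have : x ∈ X ∩ Z := ⟨hx, hxZ⟩
      rw [hXZ] at this
      exact this
    · -- `X` is dependent: a circuit `C ⊆ X`
      obtain ⟨C, hCX, hC⟩ := (dep_of_ncard_eq_four_of_eRk_le_three M hXE hX4 hXr).exists_isCircuit_subset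
      have hC3 := three_le_ncard_of_isCircuit M h0 hn hC
      rcases (C ∩ Z).eq_empty_or_nonempty with hCZ | ⟨z, hzC, hzZ⟩
      · -- `C` avoids `Z`: `C = X ∖ Z`, a rank-`2` triple, and `X = C ∪ {z}`
        left; right
        have hCsub : C ⊆ X \ Z := by
          intro x hx
          refine ⟨hCX hx, fun hxZ => ?_⟩
          have : x ∈ C ∩ Z := ⟨hx, hxZ⟩
          rw [hCZ] at this
          exact this
        have hsplit := Set.ncard_inter_add_ncard_sdiff_eq_ncard X Z hXfin
        have hXZ1 : 0 < (X ∩ Z).ncard := (Set.ncard_pos (hXfin.inter_of_left Z)).mpr hXZ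
        have hXdiff : (X \ Z).ncard ≤ 3 := by omega
        have hCle := Set.ncard_le_ncard hCsub (hXfin.subset sdiff_subset)
        have hC3' : C.ncard = 3 := by omega
        have hCeq : C = X \ Z :=
          Set.eq_of_subset_of_ncard_le hCsub (by omega) (hXfin.subset sdiff_subset)
        have hXZcard : (X ∩ Z).ncard = 1 := by omega
        obtain ⟨z, hz⟩ := Set.ncard_eq_one.mp hXZcard
        refine ⟨(C, z), ⟨?_, ?_⟩, ?_⟩
        · exact ⟨fun x hx => ⟨hXE (hCX hx), (hCsub hx).2⟩, hC3', eRk_le_two_of_isCircuit_ncard_three M hC hC3'⟩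
        · have : z ∈ X ∩ Z := by rw [hz]; exact mem_singleton z
          exact this.2
        · simp only
          rw [hCeq, ← Set.singleton_union, ← hz, Set.union_comm, Set.sdiff_union_inter]
      · -- `C` meets `Z`: `Z ⊆ C ⊆ X`
        right
        exact ⟨hXE, hX4, hXr, (hZ C hC z hzZ hzC).trans hCX⟩
  have hfin1 : {X : Set α | X ⊆ M.E \ Z ∧ X.ncard = 4 ∧ M.eRk X ≤ 3}.Finite :=
    hEfin.finite_subsets.subset (fun X hX => hX.1.trans sdiff_subset)
  have hfin2 : 𝒜.Finite := (h𝒯fin.prod hZfin).image _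
  have hfin3 : {X : Set α | X ⊆ M.E ∧ X.ncard = 4 ∧ M.eRk X ≤ 3 ∧ Z ⊆ X}.Finite :=
    hEfin.finite_subsets.subset (fun X hX => hX.1)
  calc {X : Set α | X ⊆ M.E ∧ X.ncard = 4 ∧ M.eRk X ≤ 3}.ncard
      ≤ (({X : Set α | X ⊆ M.E \ Z ∧ X.ncard = 4 ∧ M.eRk X ≤ 3} ∪ 𝒜) ∪
        {X : Set α | X ⊆ M.E ∧ X.ncard = 4 ∧ M.eRk X ≤ 3 ∧ Z ⊆ X}).ncard :=
        Set.ncard_le_ncard hsub ((hfin1.union hfin2).union hfin3)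
    _ ≤ ({X : Set α | X ⊆ M.E \ Z ∧ X.ncard = 4 ∧ M.eRk X ≤ 3} ∪ 𝒜).ncard +
        {X : Set α | X ⊆ M.E ∧ X.ncard = 4 ∧ M.eRk X ≤ 3 ∧ Z ⊆ X}.ncard := Set.ncard_union_le _ _
    _ ≤ ({X : Set α | X ⊆ M.E \ Z ∧ X.ncard = 4 ∧ M.eRk X ≤ 3}.ncard + 𝒜.ncard) +
        {X : Set α | X ⊆ M.E ∧ X.ncard = 4 ∧ M.eRk X ≤ 3 ∧ Z ⊆ X}.ncard :=
        Nat.add_le_add_right (Set.ncard_union_le _ _) _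
    _ ≤ _ := by omega

/-- No dependent `4`-set contains a set of `≥ 5` points. -/
theorem ncard_four_eRk_le_three_superset_eq_zero (M : Matroid α) [M.Finite] {Z : Set α} (hZ : 5 ≤ Z.ncard) :
    {X : Set α | X ⊆ M.E ∧ X.ncard = 4 ∧ M.eRk X ≤ 3 ∧ Z ⊆ X}.ncard = 0 := by
  rw [Set.ncard_eq_zero (M.ground_finite.finite_subsets.subset (fun X hX => hX.1))]
  rw [Set.eq_empty_iff_forall_notMem]
  rintro X ⟨hXE, hX4, _, hZX⟩
  have := Set.ncard_le_ncard hZX (M.ground_finite.subset hXE)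
  omega

/-- At most one dependent `4`-set contains a `4`-point set `Z` (namely `Z` itself). -/
theorem ncard_four_eRk_le_three_superset_le_one (M : Matroid α) [M.Finite] {Z : Set α} (hZ : Z.ncard = 4) :
    {X : Set α | X ⊆ M.E ∧ X.ncard = 4 ∧ M.eRk X ≤ 3 ∧ Z ⊆ X}.ncard ≤ 1 := by
  have hsub : {X : Set α | X ⊆ M.E ∧ X.ncard = 4 ∧ M.eRk X ≤ 3 ∧ Z ⊆ X} ⊆ {Z} := by
    rintro X ⟨hXE, hX4, _, hZX⟩
    rw [mem_singleton_iff]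
    exact (Set.eq_of_subset_of_ncard_le hZX (by omega) (M.ground_finite.subset hXE)).symm
  exact (Set.ncard_le_ncard hsub (toFinite _)).trans (by simp)

/-- The dependent `4`-sets containing a `3`-point set `Z` are among the `Z ∪ {x}`, `x ∈ E ∖ Z`: at most `n − 3`. -/
theorem ncard_four_eRk_le_three_superset_le_sub_three (M : Matroid α) [M.Finite] {Z : Set α} (hZE : Z ⊆ M.E)
    (hZ : Z.ncard = 3) :
    {X : Set α | X ⊆ M.E ∧ X.ncard = 4 ∧ M.eRk X ≤ 3 ∧ Z ⊆ X}.ncard ≤ M.E.ncard - 3 := by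
  have hEfin := M.ground_finite
  have hsub : {X : Set α | X ⊆ M.E ∧ X.ncard = 4 ∧ M.eRk X ≤ 3 ∧ Z ⊆ X} ⊆
      (fun x => insert x Z) '' (M.E \ Z) := by
    rintro X ⟨hXE, hX4, _, hZX⟩
    have hXfin : X.Finite := hEfin.subset hXE
    have hdiff : (X \ Z).ncard = 1 := by
      have := Set.ncard_sdiff_add_ncard_of_subset hZX hXfin
      omega
    obtain ⟨x, hx⟩ := Set.ncard_eq_one.mp hdiff
    have hxX : x ∈ X \ Z := by rw [hx]; exact mem_singleton x
    refine ⟨x, ⟨hXE hxX.1, hxX.2⟩, ?_⟩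
    simp only
    rw [← Set.singleton_union, ← hx, Set.sdiff_union_of_subset hZX]
  calc {X : Set α | X ⊆ M.E ∧ X.ncard = 4 ∧ M.eRk X ≤ 3 ∧ Z ⊆ X}.ncard
      ≤ ((fun x => insert x Z) '' (M.E \ Z)).ncard :=
        Set.ncard_le_ncard hsub ((hEfin.subset sdiff_subset).image _)
    _ ≤ (M.E \ Z).ncard := Set.ncard_image_le (hEfin.subset sdiff_subset)
    _ = M.E.ncard - 3 := by rw [Set.ncard_sdiff' hZE hEfin, hZ]

/-- **THE `4`-CIRCUITS THROUGH A SERIES PAIR**: for `e ≠ f` in `E` with `cl {e, f, x}` a proper flat for every `x`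
(`n ≥ ν + 4`), the `4`-circuits containing `{e, f}` number at most `(n − 2)(ν − 1)/2`:
`2·#𝒬 ≤ (n − 2)·(ν − 1)`. -/
theorem two_mul_ncard_fourCircuits_pair_le (M : Matroid α) [M.Finite] {ν : ℕ}
    (hd : M.E.encard = M.eRank + (ν : ℕ∞)) (hK : ∀ e, ¬ M.IsColoop e) {e f : α} (he : e ∈ M.E) (hf : f ∈ M.E)
    (hef : e ≠ f) (hn : ν + 4 ≤ M.E.ncard) :
    2 * {X : Set α | X ⊆ M.E ∧ X.ncard = 4 ∧ ({e, f} : Set α) ⊆ X ∧ M.IsCircuit X}.ncard ≤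
      (M.E.ncard - 2) * (ν - 1) := by
  classical
  have hEfin := M.ground_finite
  have hnE := ncard_ground_eq_eRk_toNat_add M hd
  set E' := hEfin.toFinset with hE'
  have hmemE' : ∀ x, x ∈ E' ↔ x ∈ M.E := fun x => Set.Finite.mem_toFinset hEfin
  have hcardE' : E'.card = M.E.ncard := (Set.ncard_eq_toFinset_card M.E hEfin).symm
  set s := E' \ {e, f} with hs
  have hcards : s.card = M.E.ncard - 2 := by
    rw [hs, Finset.card_sdiff_of_subset, Finset.card_pair hef, hcardE']
    intro x hx
    rw [hmemE']
    rcases Finset.mem_insert.mp hx with rfl | hx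
    · exact he
    · rw [Finset.mem_singleton.mp hx]; exact hf
  set 𝒬 := (E'.powersetCard 4).filter (fun X : Finset α => ({e, f} : Set α) ⊆ (X : Set α) ∧ M.IsCircuit (X : Set α))
    with h𝒬
  have hQ : {X : Set α | X ⊆ M.E ∧ X.ncard = 4 ∧ ({e, f} : Set α) ⊆ X ∧ M.IsCircuit X}.ncard = 𝒬.card :=
    ncard_family_eq_card_filter M 4 (fun X => ({e, f} : Set α) ⊆ X ∧ M.IsCircuit X)
  rw [hQ, ← hcards]
  have key := Finset.sum_card_bipartiteAbove_eq_sum_card_bipartiteBelow (s := s) (t := 𝒬)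
    (fun (x : α) (X : Finset α) => x ∈ X)
  -- every `4`-circuit through `e, f` has exactly two further points
  have hR : ∀ X ∈ 𝒬, (s.bipartiteBelow (fun (x : α) (X : Finset α) => x ∈ X) X).card = 2 := by
    intro X hX𝒬
    rw [h𝒬, Finset.mem_filter, Finset.mem_powersetCard] at hX𝒬
    obtain ⟨⟨hXE', hX4⟩, hefX, _⟩ := hX𝒬
    have : s.bipartiteBelow (fun (x : α) (X : Finset α) => x ∈ X) X = X \ {e, f} := by
      ext x
      rw [Finset.mem_bipartiteBelow, hs, Finset.mem_sdiff, Finset.mem_sdiff]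
      constructor
      · rintro ⟨⟨_, hxef⟩, hxX⟩; exact ⟨hxX, hxef⟩
      · rintro ⟨hxX, hxef⟩; exact ⟨⟨hXE' hxX, hxef⟩, hxX⟩
    rw [this, Finset.card_sdiff_of_subset, Finset.card_pair hef, hX4]
    intro x hx
    have hx' : x ∈ ({e, f} : Set α) := by
      rcases Finset.mem_insert.mp hx with rfl | hx
      · exact mem_insert x {f}
      · rw [Finset.mem_singleton.mp hx]; exact mem_insert_of_mem e (mem_singleton f)
    exact Finset.mem_coe.mp (hefX hx')
  -- every further point lies in at most `ν − 1` of them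
  have hL : ∀ x ∈ s, (𝒬.bipartiteAbove (fun (x : α) (X : Finset α) => x ∈ X) x).card ≤ ν - 1 := by
    intro x hxs
    rw [hs, Finset.mem_sdiff] at hxs
    obtain ⟨hxE', hxef⟩ := hxs
    have hxE : x ∈ M.E := (hmemE' x).1 hxE'
    have hxe : x ≠ e := by
      rintro rfl
      exact hxef (Finset.mem_insert_self x {f})
    have hxf : x ≠ f := by
      rintro rfl
      exact hxef (Finset.mem_insert_of_mem (Finset.mem_singleton_self x))
    -- the family, as a set family
    have hfam : (𝒬.bipartiteAbove (fun (x : α) (X : Finset α) => x ∈ X) x).card =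
        {X : Set α | X ⊆ M.E ∧ X.ncard = 4 ∧ (({e, f} : Set α) ⊆ X ∧ M.IsCircuit X) ∧ x ∈ X}.ncard := by
      rw [ncard_family_eq_card_filter M 4 (fun X => (({e, f} : Set α) ⊆ X ∧ M.IsCircuit X) ∧ x ∈ X)]
      congr 1
      ext X
      rw [Finset.mem_bipartiteAbove, h𝒬, Finset.mem_filter, Finset.mem_filter, Finset.mem_coe]
      tauto
    rw [hfam]
    -- `cl {e, f, x}` is a proper flat of rank `3`: at most `ν + 2` points
    set F := M.closure ({e, f, x} : Set α) with hF
    have hefxE : ({e, f, x} : Set α) ⊆ M.E := by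
      intro y hy
      rcases hy with rfl | rfl | rfl
      · exact he
      · exact hf
      · exact hxE
    have hFE : F ⊆ M.E := M.closure_subset_ground _
    have hFfin : F.Finite := hEfin.subset hFE
    have hrkF : (M.eRk F).toNat ≤ 3 := by
      have h1 : M.eRk F = M.eRk {e, f, x} := M.eRk_closure_eq _
      have h2 : M.eRk {e, f, x} ≤ 3 := by
        have := M.eRk_le_encard ({e, f, x} : Set α)
        have h3 : ({e, f, x} : Set α).encard ≤ 3 := by
          calc ({e, f, x} : Set α).encard ≤ ({f, x} : Set α).encard + 1 := Set.encard_insert_le _ _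
            _ ≤ ({x} : Set α).encard + 1 + 1 := by gcongr; exact Set.encard_insert_le _ _
            _ = 3 := by rw [Set.encard_singleton]; rfl
        exact this.trans h3
      rw [h1]
      have := S1.coe_toNat_eRk M hefxE
      rw [← this] at h2
      exact_mod_cast h2
    have hFne : F ≠ M.E := by
      intro hFE'
      have h1 : (M.eRk F).toNat = (M.eRk M.E).toNat := by rw [hFE']
      omega
    have hFcard : F.ncard + 1 ≤ (M.eRk F).toNat + ν :=
      ncard_add_one_le_eRk_toNat_add_of_ssubset M hd hK hFE hFne
    have hefx_sub : ({e, f, x} : Set α) ⊆ F := M.subset_closure _ hefxE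
    have hefx3 : ({e, f, x} : Set α).ncard = 3 :=
      Set.ncard_eq_three.mpr ⟨e, f, x, hef, hxe.symm, hxf.symm, rfl⟩
    have hFdiff : (F \ {e, f, x}).ncard ≤ ν - 1 := by
      have := Set.ncard_sdiff_add_ncard_of_subset hefx_sub hFfin
      omega
    -- the family injects into `F ∖ {e, f, x}` via the fourth point
    have hsub : {X : Set α | X ⊆ M.E ∧ X.ncard = 4 ∧ (({e, f} : Set α) ⊆ X ∧ M.IsCircuit X) ∧ x ∈ X} ⊆
        (fun y => insert y ({e, f, x} : Set α)) '' (F \ {e, f, x}) := by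
      rintro X ⟨hXE, hX4, ⟨hefX, hXc⟩, hxX⟩
      have hXfin : X.Finite := hEfin.subset hXE
      have hefxX : ({e, f, x} : Set α) ⊆ X := by
        intro y hy
        rcases hy with rfl | rfl | rfl
        · exact hefX (mem_insert y {f})
        · exact hefX (mem_insert_of_mem e (mem_singleton y))
        · exact hxX
      have hdiff : (X \ {e, f, x}).ncard = 1 := by
        have := Set.ncard_sdiff_add_ncard_of_subset hefxX hXfin
        omega
      obtain ⟨y, hy⟩ := Set.ncard_eq_one.mp hdiff
      have hyX : y ∈ X \ {e, f, x} := by rw [hy]; exact mem_singleton y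
      have hXeq : X = insert y {e, f, x} := by
        rw [← Set.singleton_union, ← hy, Set.sdiff_union_of_subset hefxX]
      refine ⟨y, ⟨?_, hyX.2⟩, hXeq.symm⟩
      -- `y ∈ cl {e, f, x}`: `{e, f, x} = X ∖ {y}` is independent of rank `3` and `rk X ≤ 3`
      have hind : M.Indep ({e, f, x} : Set α) := by
        have := hXc.sdiff_singleton_indep hyX.1
        have hX' : X \ {y} = {e, f, x} := by
          rw [hXeq, Set.insert_sdiff_self_of_notMem hyX.2]
        rwa [hX'] at this
      have hrk : M.eRk (insert y ({e, f, x} : Set α)) ≤ M.eRk {e, f, x} := by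
        rw [← hXeq, hind.eRk_eq_encard, ← (toFinite _).cast_ncard_eq, hefx3]
        have := hXc.eRk_add_one_eq
        rw [← hXfin.cast_ncard_eq, hX4] at this
        have hfin : M.eRk X ≠ ⊤ := ((M.eRk_le_encard X).trans_lt hXfin.encard_lt_top).ne
        obtain ⟨r, hr⟩ : ∃ r : ℕ, M.eRk X = r := ⟨_, (ENat.coe_toNat hfin).symm⟩
        rw [hr] at this ⊢
        have : r + 1 = 4 := by exact_mod_cast this
        exact_mod_cast (show r ≤ 3 by omega)
      exact mem_closure_of_eRk_insert_le M hefxE (hXE hyX.1) hrk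
    calc {X : Set α | X ⊆ M.E ∧ X.ncard = 4 ∧ (({e, f} : Set α) ⊆ X ∧ M.IsCircuit X) ∧ x ∈ X}.ncard
        ≤ ((fun y => insert y ({e, f, x} : Set α)) '' (F \ {e, f, x})).ncard :=
          Set.ncard_le_ncard hsub ((hFfin.subset sdiff_subset).image _)
      _ ≤ (F \ {e, f, x}).ncard := Set.ncard_image_le (hFfin.subset sdiff_subset)
      _ ≤ ν - 1 := hFdiff
  have hsumR : ∑ X ∈ 𝒬, (s.bipartiteBelow (fun (x : α) (X : Finset α) => x ∈ X) X).card = 𝒬.card * 2 := by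
    rw [Finset.sum_congr rfl hR, Finset.sum_const, smul_eq_mul]
  have hsumL : ∑ x ∈ s, (𝒬.bipartiteAbove (fun (x : α) (X : Finset α) => x ∈ X) x).card ≤ s.card * (ν - 1) := by
    calc ∑ x ∈ s, (𝒬.bipartiteAbove (fun (x : α) (X : Finset α) => x ∈ X) x).card
        ≤ ∑ _x ∈ s, (ν - 1) := Finset.sum_le_sum hL
      _ = s.card * (ν - 1) := by rw [Finset.sum_const, smul_eq_mul]
  rw [key, hsumR] at hsumL
  rw [mul_comm]
  exact hsumL

/-- **THE DEPENDENT `4`-SETS CONTAINING A SERIES PAIR** `{e, f}` (`f ∉ cl (E ∖ {e, f})`, circuits meeting `{e, f}`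
contain it): at most `(n − 3)` of them contain the unique rank-`2` triple through `e`, the rest are `4`-circuits. -/
theorem ncard_four_eRk_le_three_superset_pair_le (M : Matroid α) [M.Finite] (hK : ∀ e, ¬ M.IsColoop e)
    (h0 : {P : Set α | P ⊆ M.E ∧ P.ncard = 2 ∧ M.Dep P}.ncard = 0) (hn : 2 ≤ M.E.ncard) {e f : α}
    (he : e ∈ M.E) (hf : f ∈ M.E) (hef : e ≠ f) (hser : f ∉ M.closure (M.E \ {e, f}))
    (hZ : ∀ C, M.IsCircuit C → ∀ z ∈ ({e, f} : Set α), z ∈ C → ({e, f} : Set α) ⊆ C) :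
    {X : Set α | X ⊆ M.E ∧ X.ncard = 4 ∧ M.eRk X ≤ 3 ∧ ({e, f} : Set α) ⊆ X}.ncard ≤
      (M.E.ncard - 3) + {X : Set α | X ⊆ M.E ∧ X.ncard = 4 ∧ ({e, f} : Set α) ⊆ X ∧ M.IsCircuit X}.ncard := by
  have hEfin := M.ground_finite
  set 𝒯e := {T : Set α | T ⊆ M.E ∧ T.ncard = 3 ∧ M.eRk T ≤ 2 ∧ e ∈ T} with h𝒯e
  have h𝒯e1 : 𝒯e.ncard ≤ 1 := ncard_three_eRk_le_two_mem_le_one M hK h0 he hf hef hser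
  have h𝒯efin : 𝒯e.Finite := hEfin.finite_subsets.subset (fun T hT => hT.1)
  set 𝒬 := {X : Set α | X ⊆ M.E ∧ X.ncard = 4 ∧ ({e, f} : Set α) ⊆ X ∧ M.IsCircuit X} with h𝒬
  -- the sets of the first kind: `X = T ∪ {x}` with `T ∈ 𝒯e`
  set ℬ₁ := {X : Set α | ∃ T ∈ 𝒯e, ∃ x ∈ M.E \ T, X = insert x T} with hℬ₁
  have hℬ₁card : ℬ₁.ncard ≤ M.E.ncard - 3 := by
    rcases (Set.ncard_le_one_iff_eq h𝒯efin).mp h𝒯e1 with h | ⟨T₀, hT₀⟩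
    · have : ℬ₁ = ∅ := by
        rw [Set.eq_empty_iff_forall_notMem]
        rintro X ⟨T, hT, _⟩
        rw [h] at hT
        exact hT
      rw [this, Set.ncard_empty]
      exact Nat.zero_le _
    · have hT₀mem : T₀ ∈ 𝒯e := by rw [hT₀]; exact mem_singleton T₀
      have hsub : ℬ₁ ⊆ (fun x => insert x T₀) '' (M.E \ T₀) := by
        rintro X ⟨T, hT, x, hx, rfl⟩
        rw [hT₀, mem_singleton_iff] at hT
        subst hT
        exact ⟨x, hx, rfl⟩
      calc ℬ₁.ncard ≤ ((fun x => insert x T₀) '' (M.E \ T₀)).ncard :=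
            Set.ncard_le_ncard hsub ((hEfin.subset sdiff_subset).image _)
        _ ≤ (M.E \ T₀).ncard := Set.ncard_image_le (hEfin.subset sdiff_subset)
        _ = M.E.ncard - 3 := by rw [Set.ncard_sdiff' hT₀mem.1 hEfin, hT₀mem.2.1]
  have hsub : {X : Set α | X ⊆ M.E ∧ X.ncard = 4 ∧ M.eRk X ≤ 3 ∧ ({e, f} : Set α) ⊆ X} ⊆ ℬ₁ ∪ 𝒬 := by
    rintro X ⟨hXE, hX4, hXr, hefX⟩
    have hXfin : X.Finite := hEfin.subset hXE
    obtain ⟨C, hCX, hC⟩ := (dep_of_ncard_eq_four_of_eRk_le_three M hXE hX4 hXr).exists_isCircuit_subset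
    have hC3 := three_le_ncard_of_isCircuit M h0 hn hC
    have hCfin : C.Finite := hXfin.subset hCX
    -- `C` meets `{e, f}`: a circuit avoiding it would lie in the two other points
    have hCef : ({e, f} : Set α) ⊆ C := by
      rcases (C ∩ {e, f}).eq_empty_or_nonempty with hCef | ⟨z, hzC, hzef⟩
      · exfalso
        have hCsub : C ⊆ X \ {e, f} := by
          intro x hx
          refine ⟨hCX hx, fun hxef => ?_⟩
          have : x ∈ C ∩ {e, f} := ⟨hx, hxef⟩
          rw [hCef] at this
          exact this
        have := Set.ncard_le_ncard hCsub (hXfin.subset sdiff_subset)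
        rw [Set.ncard_sdiff' hefX hXfin, ncard_pair hef, hX4] at this
        omega
      · exact hZ C hC z hzef hzC
    have hCcard : C.ncard ≤ 4 := by
      have := Set.ncard_le_ncard hCX hXfin
      omega
    rcases Nat.lt_or_ge C.ncard 4 with hC3' | hC4
    · -- `C` is the rank-`2` triple through `e`, `X = C ∪ {x}`
      left
      have hC3'' : C.ncard = 3 := by omega
      have hCmem : C ∈ 𝒯e :=
        ⟨hC.subset_ground, hC3'', eRk_le_two_of_isCircuit_ncard_three M hC hC3'', hCef (mem_insert e {f})⟩
      have hdiff : (X \ C).ncard = 1 := by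
        have := Set.ncard_sdiff_add_ncard_of_subset hCX hXfin
        omega
      obtain ⟨x, hx⟩ := Set.ncard_eq_one.mp hdiff
      have hxX : x ∈ X \ C := by rw [hx]; exact mem_singleton x
      refine ⟨C, hCmem, x, ⟨hXE hxX.1, hxX.2⟩, ?_⟩
      rw [← Set.singleton_union, ← hx, Set.sdiff_union_of_subset hCX]
    · -- `C = X` is a `4`-circuit through `e, f`
      right
      have hCeq : C = X := Set.eq_of_subset_of_ncard_le hCX (by omega) hXfin
      rw [← hCeq]
      exact ⟨hC.subset_ground, by omega, hCef, hC⟩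
  have hℬ₁fin : ℬ₁.Finite := by
    refine (hEfin.finite_subsets).subset ?_
    rintro X ⟨T, hT, x, hx, rfl⟩
    exact insert_subset hx.1 hT.1
  have h𝒬fin : 𝒬.Finite := hEfin.finite_subsets.subset (fun X hX => hX.1)
  calc {X : Set α | X ⊆ M.E ∧ X.ncard = 4 ∧ M.eRk X ≤ 3 ∧ ({e, f} : Set α) ⊆ X}.ncard
      ≤ (ℬ₁ ∪ 𝒬).ncard := Set.ncard_le_ncard hsub (hℬ₁fin.union h𝒬fin)
    _ ≤ ℬ₁.ncard + 𝒬.ncard := Set.ncard_union_le _ _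
    _ ≤ (M.E.ncard - 3) + 𝒬.ncard := Nat.add_le_add_right hℬ₁card _

end S1CFG

end PercRepro
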